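import Summits.KontsevichZagierPeriods.KontsevichZagierPeriods.Theses.LiftingCriteria
import Summits.KontsevichZagierPeriods.KontsevichZagierPeriods.Theorems.HurwitzMicroSectorsNormalFormPrincipleDimOneAssembly

/-!
# `VertexKernel` in dimension `≤ 1` is unconditional (route LiftingCriteria, item stmt-KontsevichZagierPeriods-3575)

Support file for the route's pay-off item `VertexKernel`
(`Summit.KontsevichZagierPeriods.KontsevichZagierPeriods.Theses.LiftingCriteria.VertexKernel`): Conjecture 1
in kernel form for the vertex fibres `[∫_{[0,1]^{nn}} pᵢ(z/b)/qᵢ(z/b) dz]` and `[1]`. The route reaches it as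
`VertexGlue : VertexLocalLift → DilationTransfer → VertexKernel` (André's lifting + Ayoub transfer). In
dimension `nn ≤ 1` NEITHER hypothesis is needed and no threshold `b₀` either: the fibre representations
have KZ's rational shape (`pᵢ(z/b)/qᵢ(z/b)` is again a quotient of `ℚ`-polynomials, non-vanishing
denominator on the cube since `z/b ∈ [0,1]^{nn} ⊆ U`), so a vanishing `ℤ`-combination of them and of
`[1]` is a relation by **Kontsevich–Zagier's Conjecture 1 in dimension `≤ 1`**, a tree theorem
(`PiBox.Dlog.mem_relations_of_eval_eq_zero_of_dim_le_one`: Baker's theorem `baker_holds`, Viu-Sos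
compactification, normal forms). This is the `nn ≤ 1` instance of the item's signature with `b₀ = 0`
(`vertexKernel_dim_le_one`); from `nn = 2` on the fibres contain dilogarithms and the item is of the
strength of the crux `DilationTransfer` (see `LiftingCriteriaDilationTransferRationalDimLeOne.lean`).

## References
* M. Kontsevich, D. Zagier, *Periods* (2001), §1.2 Conjecture 1.
* A. Baker, *Transcendental Number Theory* (1975), Thm. 2.1.
-/

noncomputable section

open scoped BigOperators
open MeasureTheory Set
open Literature.NumberTheory.Transcendental
open Summit.KontsevichZagierPeriods.HurwitzMicroSectors.NormalFormPrinciple.PiBox.Dlog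
  (mem_relations_of_eval_eq_zero_of_dim_le_one)

namespace Summit.KontsevichZagierPeriods.LiftingCriteria.VertexKernelDimOne

/-- Rescaling the variables of a `ℚ`-polynomial by a rational constant is a `ℚ`-polynomial:
`p(c·z) = (bind₁ (c·X) p)(z)`. [folklore] -/
theorem aeval_smul_eq_aeval_bind₁ {nn : ℕ} (c : ℚ) (p : MvPolynomial (Fin nn) ℚ) (z : Fin nn → ℝ) :
    MvPolynomial.aeval ((c : ℝ) • z) p =
      MvPolynomial.aeval z (MvPolynomial.bind₁ (fun j => MvPolynomial.C c * MvPolynomial.X j) p) := by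
  rw [MvPolynomial.aeval_bind₁]
  congr 1
  ext j
  simp [Pi.smul_apply, smul_eq_mul]

/-- For a natural number `b`, the dilation `z ↦ b⁻¹ • z` maps the closed unit cube into itself
(`b⁻¹ ∈ [0,1]`, with `0⁻¹ = 0`). [folklore] -/
theorem inv_natCast_smul_mem_pi {nn : ℕ} (b : ℕ) {z : Fin nn → ℝ}
    (hz : z ∈ Set.pi Set.univ (fun _ : Fin nn => Set.Icc (0:ℝ) 1)) :
    ((b : ℝ)⁻¹) • z ∈ Set.pi Set.univ (fun _ : Fin nn => Set.Icc (0:ℝ) 1) := by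
  rw [Set.mem_univ_pi] at hz ⊢
  intro j
  have hj := hz j
  have hb0 : (0 : ℝ) ≤ (b : ℝ)⁻¹ := inv_nonneg.mpr (Nat.cast_nonneg b)
  have hb1 : (b : ℝ)⁻¹ ≤ 1 := by
    rcases Nat.eq_zero_or_pos b with rfl | hb
    · simp
    · exact inv_le_one_of_one_le₀ (by exact_mod_cast hb)
  simp only [Pi.smul_apply, smul_eq_mul, Set.mem_Icc] at hj ⊢
  exact ⟨mul_nonneg hb0 hj.1, mul_le_one₀ hb1 hj.1 hj.2⟩

/-- **`VertexKernel` for `nn ≤ 1`, unconditionally (threshold `b₀ = 0`).** For `pᵢ/qᵢ ∈ ℚ(z)`,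
`z ∈ ℝ^{nn}` with `nn ≤ 1`, regular on an open `U ⊇ [0,1]^{nn}`, every `b : ℕ`, and every vanishing
`ℤ`-combination of `[1]` and the fibres `[∫_{[0,1]^{nn}} pᵢ(z/b)/qᵢ(z/b) dz]`, the combination is a
Kontsevich–Zagier relation — the fibre representations are rational of dimension `≤ 1`
(`aeval_smul_eq_aeval_bind₁`), and Conjecture 1 holds in dimension `≤ 1`
(`mem_relations_of_eval_eq_zero_of_dim_le_one`, Baker). [cite: KontsevichZagier2001, §1.2 Conjecture 1] -/
theorem vertexKernel_dim_le_one :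
    ∀ (nn S : ℕ), nn ≤ 1 → ∀ (p q : Fin S → MvPolynomial (Fin nn) ℚ) (U : Set (Fin nn → ℝ)), IsOpen U → Set.pi Set.univ (fun _ : Fin nn => Set.Icc (0:ℝ) 1) ⊆ U → (∀ i, ∀ z ∈ U, MvPolynomial.aeval z (q i) ≠ 0) → ∃ b₀ : ℕ, ∀ b : ℕ, b₀ ≤ b → ∀ (m : Fin S → ℤ) (m₀ : ℤ), ∀ (r : Fin S → Literature.NumberTheory.Transcendental.KZ.IntegralRep nn) (u : Literature.NumberTheory.Transcendental.KZ.IntegralRep 0), (∀ i, (r i).domain = Set.pi Set.univ (fun _ : Fin nn => Set.Icc (0:ℝ) 1) ∧ ∀ z ∈ Set.pi Set.univ (fun _ : Fin nn => Set.Icc (0:ℝ) 1), (r i).integrand z = MvPolynomial.aeval (((b : ℝ)⁻¹) • z) (p i) / MvPolynomial.aeval (((b : ℝ)⁻¹) • z) (q i)) → u.domain = Set.univ → (∀ x, u.integrand x = 1) → Literature.NumberTheory.Transcendental.KZ.eval (m₀ • Literature.NumberTheory.Transcendental.KZ.of u + ∑ i, m i • Literature.NumberTheory.Transcendental.KZ.of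 (r i)) = 0 → m₀ • Literature.NumberTheory.Transcendental.KZ.of u + ∑ i, m i • Literature.NumberTheory.Transcendental.KZ.of (r i) ∈ Literature.NumberTheory.Transcendental.KZ.relations := by
  intro nn S hnn p q U _hU hcube hq
  refine ⟨0, fun b _ m m₀ r u hr hu1 hu2 heval => ?_⟩
  -- the fibre representations have KZ's rational shape
  have hcast : ((b : ℝ)⁻¹) = (((b : ℚ)⁻¹ : ℚ) : ℝ) := by push_cast; rfl
  have hrR : ∀ i, (r i).IsRational := by
    intro i
    refine ⟨MvPolynomial.bind₁ (fun j => MvPolynomial.C ((b : ℚ)⁻¹) * MvPolynomial.X j) (p i),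
      MvPolynomial.bind₁ (fun j => MvPolynomial.C ((b : ℚ)⁻¹) * MvPolynomial.X j) (q i),
      fun z hz => ?_, fun z hz => ?_⟩
    · rw [(hr i).1] at hz
      rw [← aeval_smul_eq_aeval_bind₁, ← hcast]
      exact hq i _ (hcube (inv_natCast_smul_mem_pi b hz))
    · rw [(hr i).1] at hz
      show (r i).integrand z = _ / _
      rw [(hr i).2 z hz, ← aeval_smul_eq_aeval_bind₁, ← aeval_smul_eq_aeval_bind₁, ← hcast]
  have huR : u.IsRational :=
    ⟨1, 1, fun x _ => by simp, fun x _ => by simp [hu2 x]⟩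
  -- membership in the subgroup generated by rational representations of dimension `≤ 1`
  set Y : Set KZ.FormalRep :=
    {y : KZ.FormalRep | ∃ (k : ℕ) (N : KZ.IntegralRep k), k ≤ 1 ∧ N.IsRational ∧ y = KZ.of N} with hY
  have hYu : KZ.of u ∈ Y := ⟨0, u, Nat.zero_le _, huR, rfl⟩
  have hYr : ∀ i, KZ.of (r i) ∈ Y := fun i => ⟨nn, r i, hnn, hrR i, rfl⟩
  have hmem : m₀ • KZ.of u + ∑ i, m i • KZ.of (r i) ∈ AddSubgroup.closure Y :=
    AddSubgroup.add_mem _ (AddSubgroup.zsmul_mem _ (AddSubgroup.subset_closure hYu) _)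
      (AddSubgroup.sum_mem _ fun i _ =>
        AddSubgroup.zsmul_mem _ (AddSubgroup.subset_closure (hYr i)) _)
  exact mem_relations_of_eval_eq_zero_of_dim_le_one hmem heval

end Summit.KontsevichZagierPeriods.LiftingCriteria.VertexKernelDimOne
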